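import Literature.RingTheory.TwoVariableSeries.LeadingForm
import HarnessLib

/-!
# Two-variable formal power series: leading forms of polynomial expressions (no cancellation)

Topic: `Literature/RingTheory/TwoVariableSeries`. Given two nonzero series `q₀, q₁ ∈ F[[X, Y]]`
of orders `n₀, n₁` with leading forms `φ₀, φ₁`, and a polynomial `h(U, V)`, the series
`h(q₀, q₁)` has all homogeneous components of degree `d ≤ min-weight(h)` equal to the
**line form** `Σ_{n₀ j + n₁ k = d} h_{jk} φ₀ʲ φ₁ᵏ` (`homogeneousComponent_aeval_eq_lineForm`);
hence if the line form in the minimal weighted degree `d₀` of `h` does not vanish — NO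
CANCELLATION among the leading forms — then `ord h(q₀,q₁) = d₀` and `L(h(q₀,q₁))` is that line
form (`order_aeval_eq_and_leadingForm_eq`). Non-vanishing is supplied by a triangularity
criterion (`lineForm_ne_zero_of_triangular`): an extremal monomial `ν(j,k)` occurring in
`φ₀ʲφ₁ᵏ` but in no `φ₀^{j'} φ₁^{k'}` of smaller rank on the same line.

This is the elementary substitute, used by the discharge of Cutkosky's Lemma 3.1
(`Literature.Barriers.ResolutionOfSingularities.Cutkosky.CutkoskyLemma31`), for the Weierstrass
preparation argument of the printed proof: it computes leading forms of ALL elements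
`h(u,v)/g(u,v)` of `k[u,v]_{(u,v)}` inside `k[[x,y]]` at once. Everything here is [folklore].
-/

noncomputable section

namespace Literature.RingTheory.TwoVariableSeries

open _root_.MvPowerSeries Finsupp

universe u

variable {F : Type u} [Field F]

/-! ## Evaluating polynomials at power series -/

/-- The constant term of `h(q₀, q₁)` is `h` evaluated at the constant terms. [folklore] -/
theorem constantCoeff_aeval (q : Fin 2 → MvPowerSeries (Fin 2) F) (h : MvPolynomial (Fin 2) F) :
    constantCoeff (MvPolynomial.aeval q h) = MvPolynomial.eval (fun i => constantCoeff (q i)) h := by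
  induction h using MvPolynomial.induction_on with
  | C a =>
    rw [MvPolynomial.aeval_C, MvPolynomial.eval_C]
    exact constantCoeff_C a
  | add f g hf hg => rw [map_add, map_add, hf, hg, map_add]
  | mul_X f i hf => rw [map_mul, map_mul, hf, MvPolynomial.aeval_X, map_mul, MvPolynomial.eval_X]

/-- If the `qᵢ` vanish at the origin, the constant term of `h(q₀,q₁)` is `h(0)`. [folklore] -/
theorem constantCoeff_aeval_of_constantCoeff_eq_zero (q : Fin 2 → MvPowerSeries (Fin 2) F)
    (hq : ∀ i, constantCoeff (q i) = 0) (h : MvPolynomial (Fin 2) F) :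
    constantCoeff (MvPolynomial.aeval q h) = MvPolynomial.constantCoeff h := by
  have h0 : (fun i => constantCoeff (q i)) = 0 := funext hq
  rw [constantCoeff_aeval, h0, MvPolynomial.eval_zero]

/-! ## Line forms are the low homogeneous components -/

/-- The order of a nonzero series is read off from the degree of its (homogeneous) leading form.
[folklore] -/
theorem order_toNat_eq_of_isHomogeneous_leadingForm {f : MvPowerSeries (Fin 2) F} (hf : f ≠ 0) {n : ℕ}
    (hn : IsHomogeneous (leadingForm f) n) : f.order.toNat = n := by
  have hL := leadingForm_ne_zero hf
  obtain ⟨d, hd⟩ : ∃ d, coeff d (leadingForm f) ≠ 0 := by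
    by_contra hall
    push Not at hall
    exact hL (MvPowerSeries.ext fun d => by rw [hall d, map_zero])
  have h1 := isHomogeneous_leadingForm f hd
  have h2 := hn hd
  exact h1.symm.trans h2

/-- Order and leading form of `c · q₀ʲ q₁ᵏ` (`c ≠ 0`, `qᵢ ≠ 0`): order `n₀ j + n₁ k`, leading form
`c · L(q₀)ʲ L(q₁)ᵏ`. [folklore] -/
theorem order_and_leadingForm_C_mul_pow_mul_pow (q : Fin 2 → MvPowerSeries (Fin 2) F)
    (hq : ∀ i, q i ≠ 0) {c : F} (hc : c ≠ 0) (e : Fin 2 →₀ ℕ) :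
    (C c * (q 0 ^ e 0 * q 1 ^ e 1)).order.toNat = weight (wt q) e ∧
    leadingForm (C c * (q 0 ^ e 0 * q 1 ^ e 1)) =
      C c * (leadingForm (q 0) ^ e 0 * leadingForm (q 1) ^ e 1) := by
  have hL : leadingForm (C c * (q 0 ^ e 0 * q 1 ^ e 1)) =
      C c * (leadingForm (q 0) ^ e 0 * leadingForm (q 1) ^ e 1) := by
    rw [leadingForm_mul, leadingForm_mul, leadingForm_pow, leadingForm_pow,
      leadingForm_of_constantCoeff_ne_zero (f := C c) (by rwa [constantCoeff_C]), constantCoeff_C]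
  refine ⟨?_, hL⟩
  have hne : C c * (q 0 ^ e 0 * q 1 ^ e 1) ≠ 0 :=
    mul_ne_zero (by rwa [Ne, map_eq_zero_iff _ (C_injective (σ := Fin 2) (R := F))])
      (mul_ne_zero (pow_ne_zero _ (hq 0)) (pow_ne_zero _ (hq 1)))
  apply order_toNat_eq_of_isHomogeneous_leadingForm hne
  rw [hL, weight_wt_eq, show e 0 * wt q 0 + e 1 * wt q 1 = 0 + (wt q 0 * e 0 + wt q 1 * e 1) by ring]
  exact IsHomogeneous.mul (isHomogeneous_C c)
    (IsHomogeneous.mul (IsHomogeneous.pow_fin2 (isHomogeneous_leadingForm (q 0)) _)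
      (IsHomogeneous.pow_fin2 (isHomogeneous_leadingForm (q 1)) _))

/-- **Homogeneous components of `h(q₀,q₁)` up to the minimal weight are line forms**: if every
exponent in the support of `h` has weight `≥ d` then the degree-`d` component of `h(q₀,q₁)` is the
line form of `h` in weighted degree `d`. [folklore] -/
theorem homogeneousComponent_aeval_eq_lineForm (q : Fin 2 → MvPowerSeries (Fin 2) F) (hq : ∀ i, q i ≠ 0)
    (h : MvPolynomial (Fin 2) F) {d : ℕ} (hd : ∀ e ∈ h.support, d ≤ weight (wt q) e) :
    homogeneousComponent d (MvPolynomial.aeval q h) = lineForm q h d := by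
  classical
  conv_lhs => rw [h.as_sum, map_sum, map_sum]
  rw [lineForm, Finset.sum_filter]
  refine Finset.sum_congr rfl fun e he => ?_
  have hc : MvPolynomial.coeff e h ≠ 0 := MvPolynomial.mem_support_iff.mp he
  rw [aeval_monomial_fin2]
  obtain ⟨hord, hL⟩ := order_and_leadingForm_C_mul_pow_mul_pow q hq hc e
  have hne : C (MvPolynomial.coeff e h) * (q 0 ^ e 0 * q 1 ^ e 1) ≠ 0 := by
    intro h0
    rw [h0, leadingForm_zero] at hL
    refine mul_ne_zero ?_ (mul_ne_zero (pow_ne_zero _ (leadingForm_ne_zero (hq 0)))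
      (pow_ne_zero _ (leadingForm_ne_zero (hq 1)))) hL.symm
    rwa [Ne, map_eq_zero_iff _ (C_injective (σ := Fin 2) (R := F))]
  split_ifs with hwd
  · rw [← hL, leadingForm, hord, hwd]
  · apply homogeneousComponent_of_lt_order_eq_zero
    rw [← order_toNat_eq hne, hord, Nat.cast_lt]
    exact lt_of_le_of_ne (hd e he) (Ne.symm hwd)

/-- Below the minimal weight the line form is empty. [folklore] -/
theorem lineForm_eq_zero_of_lt (q : Fin 2 → MvPowerSeries (Fin 2) F) (h : MvPolynomial (Fin 2) F) {d : ℕ}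
    (hd : ∀ e ∈ h.support, d < weight (wt q) e) : lineForm q h d = 0 := by
  rw [lineForm]
  apply Finset.sum_eq_zero
  intro e he
  rw [Finset.mem_filter] at he
  exact ((hd e he.1).ne he.2.symm).elim

/-- **No cancellation ⇒ order and leading form of `h(q₀,q₁)`**: if every exponent of `h` has
weight `≥ d₀` and the line form in weighted degree `d₀` is nonzero, then `ord h(q₀,q₁) = d₀` and
`L(h(q₀,q₁))` is that line form. [folklore] -/
theorem order_aeval_eq_and_leadingForm_eq (q : Fin 2 → MvPowerSeries (Fin 2) F) (hq : ∀ i, q i ≠ 0)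
    (h : MvPolynomial (Fin 2) F) {d₀ : ℕ} (hd : ∀ e ∈ h.support, d₀ ≤ weight (wt q) e)
    (hne : lineForm q h d₀ ≠ 0) :
    (MvPolynomial.aeval q h).order = d₀ ∧ leadingForm (MvPolynomial.aeval q h) = lineForm q h d₀ := by
  rw [← homogeneousComponent_aeval_eq_lineForm q hq h hd] at hne ⊢
  refine order_eq_and_leadingForm_eq hne fun m hm => ?_
  have hm' : ∀ e ∈ h.support, degree m ≤ weight (wt q) e := fun e he => (hm.trans_le (hd e he)).le
  have key := homogeneousComponent_aeval_eq_lineForm q hq h hm'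
  rw [lineForm_eq_zero_of_lt q h (fun e he => hm.trans_le (hd e he))] at key
  have := congrArg (coeff m) key
  rwa [coeff_homogeneousComponent, if_pos rfl, map_zero] at this

/-! ## The triangularity criterion for no cancellation -/

/-- **Triangularity ⇒ no cancellation.** On the line of weighted degree `d`, suppose a rank `ρ`
(injective on the exponents of `h` on the line) and test monomials `ν` are given such that the
coefficient of `ν(e)` vanishes in `L(q₀)^{e'₀} L(q₁)^{e'₁}` for every `e'` of smaller rank and is
nonzero in `L(q₀)^{e₀} L(q₁)^{e₁}`. If `h` has an exponent on the line then the line form is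
nonzero (look at the coefficient of `ν(e*)` for `e*` of maximal rank). [folklore] -/
theorem lineForm_ne_zero_of_triangular (q : Fin 2 → MvPowerSeries (Fin 2) F) (h : MvPolynomial (Fin 2) F)
    (d : ℕ) (ρ : (Fin 2 →₀ ℕ) → ℕ) (ν : (Fin 2 →₀ ℕ) → (Fin 2 →₀ ℕ))
    (hinj : ∀ e ∈ h.support, ∀ e' ∈ h.support, weight (wt q) e = d → weight (wt q) e' = d →
      ρ e = ρ e' → e = e')
    (htri : ∀ e ∈ h.support, ∀ e' ∈ h.support, weight (wt q) e = d → weight (wt q) e' = d →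
      ρ e' < ρ e → coeff (ν e) (leadingForm (q 0) ^ e' 0 * leadingForm (q 1) ^ e' 1) = 0)
    (hdiag : ∀ e ∈ h.support, weight (wt q) e = d →
      coeff (ν e) (leadingForm (q 0) ^ e 0 * leadingForm (q 1) ^ e 1) ≠ 0)
    (hex : ∃ e ∈ h.support, weight (wt q) e = d) : lineForm q h d ≠ 0 := by
  classical
  set S := h.support.filter fun e => weight (wt q) e = d with hS
  have hSne : S.Nonempty := by
    obtain ⟨e, he, hwe⟩ := hex
    exact ⟨e, Finset.mem_filter.mpr ⟨he, hwe⟩⟩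
  obtain ⟨e₀, he₀, hmax⟩ := Finset.exists_max_image S ρ hSne
  obtain ⟨he₀s, hwe₀⟩ := Finset.mem_filter.mp he₀
  intro hzero
  have hcoeff := congrArg (coeff (ν e₀)) hzero
  rw [lineForm, map_zero, ← hS, map_sum, Finset.sum_eq_single e₀] at hcoeff
  · rw [coeff_C_mul] at hcoeff
    rcases mul_eq_zero.mp hcoeff with h1 | h1
    · exact (MvPolynomial.mem_support_iff.mp he₀s) h1
    · exact hdiag e₀ he₀s hwe₀ h1
  · intro e he hne
    obtain ⟨hes, hwe⟩ := Finset.mem_filter.mp he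
    rw [coeff_C_mul, htri e₀ he₀s e hes hwe₀ hwe, mul_zero]
    exact lt_of_le_of_ne (hmax e he) fun heq => hne (hinj e hes e₀ he₀s hwe hwe₀ heq)
  · intro hn
    exact (hn he₀).elim

end Literature.RingTheory.TwoVariableSeries
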